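import Summits.CriticalPhenomena.CardyFormulaZ2.Theses.CardyDualCurrent

/-!
# Birth skeleton — crux `CardyDualCurrent.CanonicalLimitFromExactCR` (item stmt-CriticalPhenomena-11394)

Route `route-CriticalPhenomena-CardyDualCurrent`, sub-problem `CardyFormulaZ2`, crux (rank 4)
`Summit.CriticalPhenomena.CardyFormulaZ2.Theses.CardyDualCurrent.CanonicalLimitFromExactCR`:
an exactly discrete-holomorphic (Duffin Cauchy–Riemann at every deep primal vertex and face),
deep-window non-degenerate finite-range local parafermionic template (the body of
`DualCurrentTemplateR`) forces the CANONICAL spin-`1/3` scaling limit along every admissible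
square-lattice discretisation family: some template and a lattice constant `C > 0` satisfy
`θ_δ · C · δ^{-1/3} · G_{E δ}(⌊w/δ⌋, i) → q`, `q³ = ψ'/ψ`, locally uniformly on `D`, for every
Dobrushin domain `D`, every `ZdDiscretisationFamily E`, every chordal uniformizer `φ = ψ⁻¹` and
every holomorphic branch `q` (the body of `TemplateCanonicalLimit`; Smirnov 2010 Thm 2.2 /
Conj. 2.4 at `σ = 1/3`).

## The cut: SHAPE and SIZE of the limit

At `σ = 1/2` Smirnov's discrete primitive `H = Im ∫ F²` delivers shape and normalisation at once
(its boundary values are `0`/`1`).  At `σ = 1/3` no integrable primitive is known (the crux's own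
"why it might fail": one would need `Im ∫ F³ dz` discretely), so the two halves of the conclusion
are genuinely different problems and are cut apart here:

* `stub_projectiveShape` — **canonical shape** (Smirnov's theorem modulo normalisation): from a
  witness of `DualCurrentTemplateR` one gets an exactly-CR, deep-window non-degenerate template
  (possibly re-chosen at finite range near the boundary) whose observable converges
  PROJECTIVELY to the canonical function: for every `(D, E, φ, q)` there are complex normalisers
  `c_δ` (free modulus and phase, one family for both edge types `i = 0, 1`) with
  `c_δ · G_{E δ}(⌊w/δ⌋, i) → q(w)` locally uniformly on `D`.  Expected proof: exact CR ⇒ discrete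
  Cauchy/Morera + Harnack-type precompactness after an empirical normalisation, RSW control of
  the width-`r` boundary layer where CR is not demanded, identification of every subsequential
  limit by uniqueness of the spin-`1/3` Riemann–Hilbert problem `Im(f · τ^{1/3}) = 0`
  (Smirnov 2010 §2 and Rem. 2.3; Chelkak–Smirnov 2012; DCS 2012 §5–6, Conj. 8.7 at `q = 1`).
* `stub_canonicalAmplitude` — **canonical size** (sharp amplitude of the one-point function):
  for every exactly-CR non-degenerate template there is ONE lattice constant `C > 0` such that,
  whenever complex normalisers `c_δ` realise the projective convergence above (any `D, E, φ, q`),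
  `‖c_δ‖ · δ^{1/3} → C` as `δ → 0⁺` — i.e. `|G_{E δ}(⌊w/δ⌋, i)| = C⁻¹ δ^{1/3} |q(w)| (1 + o(1))`:
  the exponent `σ = 1/3` is sharp (no logarithmic correction) and the amplitude is universal in
  the domain, the discretisation family, the uniformizer and the branch (`ψ'/ψ` does not depend
  on `φ`; branches differ by cube roots of unity; `q` is zero-free by
  `deriv_symm_div_symm_ne_zero`).  This is the part Smirnov's `σ = 1/2` argument gets for free
  from `H` and which at `σ = 1/3` must come from elsewhere (boundary behaviour on the free arc,
  or sharp two-arm-with-phase asymptotics).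

`CanonicalLimitFromExactCR_of` assembles them with a sorry-free analytic normalisation lemma
(`phase_normalisation`): writing `c_δ = ‖c_δ‖ θ_δ`, the unit phases `θ_δ` are the ones the crux
asks for, because `θ_δ C δ^{-1/3} G = ρ_δ · (c_δ G)` with the REAL scalars
`ρ_δ = C δ^{-1/3} / ‖c_δ‖ → 1`, and real scalars tending to one preserve locally uniform
convergence to a continuous limit (`tendstoLocallyUniformlyOn_ofReal_mul`, an `ε/4` argument) —
up to an eventual (`c_δ ≠ 0` for small `δ`) congruence (`tendstoLocallyUniformlyOn_of_eventuallyEq`).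

Disproof used: none filed for this crux (`Cruxes/CanonicalLimitFromExactCR/` had no
`Disproof.lean` and no other workfile at registration, 2026-08-17); no landed `Negative/` lemma.
Refuter/grounder notes honoured: the item is `DualCurrentTemplateR → TemplateCanonicalLimit`
(`Iff.rfl`), `q` is zero-free and `|G| = O(1)`, so neither stub is witnessed by a junk / zero
template; both stubs keep the exact-CR antecedent, so each is exactly as plausible as the crux.
-/

namespace Summit.CriticalPhenomena.CardyFormulaZ2.Cruxes.CanonicalLimitFromExactCR.Birth

open scoped BigOperators Topology Manifold Classical MeasureTheory ProbabilityTheory Matrix InnerProductSpace ComplexConjugate ContinuousMap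
open Filter Set Function TopologicalSpace MeasureTheory
open Summit.CriticalPhenomena.CardyFormulaZ2.Theses.CardyDualCurrent (CanonicalLimitFromExactCR DualCurrentTemplateR)

/-! ### Analytic glue for the assembly (sorry-free) -/

section Glue

variable {ι α β : Type*} [TopologicalSpace α]

/-- Locally uniform convergence on a set is insensitive to an EVENTUAL (in the index filter)
modification of the approximants on the set. [folklore] -/
theorem tendstoLocallyUniformlyOn_of_eventuallyEq [UniformSpace β] {F F' : ι → α → β}
    {f : α → β} {p : Filter ι} {s : Set α} (h : TendstoLocallyUniformlyOn F f p s)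
    (h' : ∀ᶠ n in p, ∀ y ∈ s, F n y = F' n y) : TendstoLocallyUniformlyOn F' f p s := by
  intro u hu x hx
  obtain ⟨t, ht, hev⟩ := h u hu x hx
  refine ⟨t ∩ s, inter_mem ht self_mem_nhdsWithin, ?_⟩
  filter_upwards [hev, h'] with n hn hn' y hy
  rw [← hn' y hy.2]
  exact hn y hy.1

/-- Real scalars tending to one preserve locally uniform convergence to a CONTINUOUS limit:
if `G_n → q` locally uniformly on `s`, `q` is continuous on `s` and `ρ_n → 1`, then
`ρ_n G_n → q` locally uniformly on `s` (an `ε/4`-argument; `q` is locally bounded on `s`).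
[folklore] -/
theorem tendstoLocallyUniformlyOn_ofReal_mul {G : ι → α → ℂ} {q : α → ℂ} {p : Filter ι}
    {s : Set α} {ρ : ι → ℝ} (hG : TendstoLocallyUniformlyOn G q p s) (hq : ContinuousOn q s)
    (hρ : Tendsto ρ p (𝓝 1)) :
    TendstoLocallyUniformlyOn (fun n w => (ρ n : ℂ) * G n w) q p s := by
  rw [Metric.tendstoLocallyUniformlyOn_iff] at hG ⊢
  intro ε hε x hx
  have hε' : 0 < ε := hε
  have hM : 0 < ‖q x‖ + 1 := by positivity
  obtain ⟨t, ht, hev⟩ := hG (ε / 4) (by positivity) x hx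
  have hqx : ∀ᶠ y in 𝓝[s] x, dist (q y) (q x) < 1 :=
    Metric.tendsto_nhds.mp (hq x hx).tendsto 1 one_pos
  refine ⟨t ∩ {y | dist (q y) (q x) < 1}, inter_mem ht hqx, ?_⟩
  have hρev : ∀ᶠ n in p, dist (ρ n) 1 < min (1 / 2) (ε / (4 * (‖q x‖ + 1))) :=
    Metric.tendsto_nhds.mp hρ _ (lt_min one_half_pos (by positivity))
  filter_upwards [hev, hρev] with n hn hρn y hy
  obtain ⟨hyt, hyq⟩ := hy
  have h1 : dist (q y) (G n y) < ε / 4 := hn y hyt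
  have hyq' : dist (q y) (q x) < 1 := hyq
  have hqy : ‖q y‖ < ‖q x‖ + 1 := by
    have e : q x + (q y - q x) = q y := by ring
    calc ‖q y‖ = ‖q x + (q y - q x)‖ := by rw [e]
      _ ≤ ‖q x‖ + ‖q y - q x‖ := norm_add_le _ _
      _ < ‖q x‖ + 1 := by rw [← dist_eq_norm]; linarith
  rw [Real.dist_eq] at hρn
  have hρ1 : |ρ n - 1| < 1 / 2 := lt_of_lt_of_le hρn (min_le_left _ _)
  have hρ2 : |ρ n - 1| < ε / (4 * (‖q x‖ + 1)) := lt_of_lt_of_le hρn (min_le_right _ _)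
  have hρabs : |ρ n| < 3 / 2 := by
    have := abs_sub_abs_le_abs_sub (ρ n) 1
    rw [abs_one] at this
    linarith
  have hA : |ρ n| * dist (q y) (G n y) ≤ 3 / 2 * (ε / 4) :=
    mul_le_mul hρabs.le h1.le dist_nonneg (by norm_num)
  have hB : |1 - ρ n| * ‖q y‖ ≤ ε / (4 * (‖q x‖ + 1)) * (‖q x‖ + 1) := by
    rw [abs_sub_comm]
    exact mul_le_mul hρ2.le hqy.le (norm_nonneg _) (by positivity)
  have hE : ε / (4 * (‖q x‖ + 1)) * (‖q x‖ + 1) = ε / 4 := by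
    rw [div_mul_eq_mul_div, mul_div_mul_right _ _ hM.ne']
  have key : q y - (ρ n : ℂ) * G n y = (ρ n : ℂ) * (q y - G n y) + ((1 - ρ n : ℝ) : ℂ) * q y := by
    push_cast
    ring
  show dist (q y) ((ρ n : ℂ) * G n y) < ε
  calc dist (q y) ((ρ n : ℂ) * G n y)
      = ‖(ρ n : ℂ) * (q y - G n y) + ((1 - ρ n : ℝ) : ℂ) * q y‖ := by rw [dist_eq_norm, key]
    _ ≤ ‖(ρ n : ℂ) * (q y - G n y)‖ + ‖((1 - ρ n : ℝ) : ℂ) * q y‖ := norm_add_le _ _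
    _ = |ρ n| * dist (q y) (G n y) + |1 - ρ n| * ‖q y‖ := by
        rw [norm_mul, norm_mul, Complex.norm_real, Complex.norm_real, Real.norm_eq_abs,
          Real.norm_eq_abs, dist_eq_norm]
    _ ≤ 3 / 2 * (ε / 4) + ε / (4 * (‖q x‖ + 1)) * (‖q x‖ + 1) := add_le_add hA hB
    _ < ε := by rw [hE]; linarith

/-- **Phase normalisation.** If complex normalisers `c_δ` make `c_δ · F_i(δ, ·) → q` locally
uniformly on `s` (both `i`), `q` is continuous on `s`, and the normalisers have the sharp size
`‖c_δ‖ · δ^{1/3} → C > 0`, then the unit phases `θ_δ = c_δ / ‖c_δ‖` give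
`θ_δ · C · δ^{-1/3} · F_i(δ, ·) → q` locally uniformly on `s` — the exact shape of the crux's
conclusion. [folklore] -/
theorem phase_normalisation {s : Set α} {F : Fin 2 → ℝ → α → ℂ} {q : α → ℂ} {c : ℝ → ℂ}
    {C : ℝ} (hC : 0 < C) (hq : ContinuousOn q s)
    (hc : ∀ i : Fin 2, TendstoLocallyUniformlyOn (fun (δ : ℝ) (w : α) => c δ * F i δ w) q
      (𝓝[>] (0 : ℝ)) s)
    (hT : Tendsto (fun δ : ℝ => ‖c δ‖ * δ ^ (1 / 3 : ℝ)) (𝓝[>] (0 : ℝ)) (𝓝 C)) :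
    ∃ θ : ℝ → ℂ, (∀ δ, ‖θ δ‖ = 1) ∧ ∀ i : Fin 2, TendstoLocallyUniformlyOn
      (fun (δ : ℝ) (w : α) => θ δ * C * ((δ ^ (-(1 / 3 : ℝ)) : ℝ) : ℂ) * F i δ w) q
      (𝓝[>] (0 : ℝ)) s := by
  classical
  refine ⟨fun δ => if c δ = 0 then 1 else ((‖c δ‖⁻¹ : ℝ) : ℂ) * c δ, fun δ => ?_, fun i => ?_⟩
  · show ‖(if c δ = 0 then (1 : ℂ) else ((‖c δ‖⁻¹ : ℝ) : ℂ) * c δ)‖ = 1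
    split_ifs with h
    · exact norm_one
    · rw [norm_mul, Complex.norm_real, norm_inv, norm_norm,
        inv_mul_cancel₀ (norm_ne_zero_iff.mpr h)]
  · -- the normalisers are eventually non-zero
    have hne : ∀ᶠ δ in 𝓝[>] (0 : ℝ), c δ ≠ 0 := by
      filter_upwards [hT.eventually_const_lt (half_lt_self hC)] with δ hδ h0
      rw [h0, norm_zero, zero_mul] at hδ
      linarith
    -- the real correction factor tends to one
    have hρ : Tendsto (fun δ : ℝ => ‖c δ‖⁻¹ * C * δ ^ (-(1 / 3 : ℝ))) (𝓝[>] (0 : ℝ)) (𝓝 1) := by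
      have h2 : Tendsto (fun δ : ℝ => C * (‖c δ‖ * δ ^ (1 / 3 : ℝ))⁻¹) (𝓝[>] (0 : ℝ))
          (𝓝 (C * C⁻¹)) := (hT.inv₀ hC.ne').const_mul C
      rw [mul_inv_cancel₀ hC.ne'] at h2
      refine h2.congr' ?_
      filter_upwards [self_mem_nhdsWithin] with δ hδ
      rw [Set.mem_Ioi] at hδ
      rw [Real.rpow_neg hδ.le, mul_inv]
      ring
    refine tendstoLocallyUniformlyOn_of_eventuallyEq
      (tendstoLocallyUniformlyOn_ofReal_mul (hc i) hq hρ) ?_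
    filter_upwards [hne, self_mem_nhdsWithin] with δ hδ hpos y hy
    try dsimp only
    rw [if_neg hδ]
    push_cast
    ring

end Glue

/-! ### The two stub statements as named `Prop`s

`CanonicalLimitFromExactCR_of` takes exactly the two propositions `Stubs.stub_*` BY NAME; the
registered stubs `stub_*` below restate them verbatim over tree declarations and are the ONLY
declarations of this file that use `sorry`; the final `example` checks that the two spellings
agree definitionally (`CanonicalLimitFromExactCR_of stub₁ stub₂ : CanonicalLimitFromExactCR`). -/

namespace Stubs

/-- Stub `Prop` 1 — canonical SHAPE (registered stub: the theorem `stub_projectiveShape`). -/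
def stub_projectiveShape : Prop :=
  Summit.CriticalPhenomena.CardyFormulaZ2.Theses.CardyDualCurrent.DualCurrentTemplateR → ∃ (r m : ℕ) (z : Fin 2 → Fin m → Literature.Probability.LatticeModels.MedialVertex) (s : Fin 2 → Fin m → ℝ) (g : Fin 2 → Fin m → Set Literature.Probability.LatticeModels.MedialVertex → ℂ), (∀ i k, Literature.Probability.LatticeModels.medialGraph.edist s((0 : Literature.Probability.LatticeModels.Site 2), Pi.single i 1) (z i k) ≤ (r : ℕ∞)) ∧ (let G : Literature.Probability.LatticeModels.DiscreteDobrushin → Literature.Probability.LatticeModels.Site 2 → Fin 2 → ℂ := fun D x i => ∫ cfg, (∑ k, g i k {e | Literature.Probability.LatticeModels.medialGraph.edist s((0 : Literature.Probability.LatticeModels.Site 2), Pi.single i 1) e ≤ (r : ℕ∞) ∧ Sym2.map (· + x) e ∈ cfg} * Literature.Probability.LatticeModels.passageSum (Literature.Probability.LatticeModels.fkInterface D cfg) D.δ (s i k) (Sym2.map (· + x) (z i k))) ∂(Literature.Probability.Percolation.bondPercolation (Literature.Probability.LatticeModels.zdGraph 2) Literature.Probability.Percolation.half); let W : Literature.Probability.LatticeModels.DiscreteDobrushin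 → Literature.Probability.LatticeModels.Site 2 → Fin 2 → ℕ → Prop := fun D x i ρ => ∀ e, Literature.Probability.LatticeModels.medialGraph.edist s((0 : Literature.Probability.LatticeModels.Site 2), Pi.single i 1) e ≤ (ρ : ℕ∞) → Sym2.map (· + x) e ∈ D.innerMedialVertices; (∀ D : Literature.Probability.LatticeModels.DiscreteDobrushin, D.IsZdAdmissible → ((Literature.Probability.LatticeModels.discreteDomainGraph D.Ω D.δ).induce D.zdArcA).Preconnected → (∀ x, W D x 0 r → W D x 1 r → W D (x - Pi.single 0 1) 0 r → W D (x - Pi.single 1 1) 1 r → G D x 1 - G D (x - Pi.single 1 1) 1 = Complex.I * (G D x 0 - G D (x - Pi.single 0 1) 0)) ∧ (∀ f, W D f 0 r → W D (f + Pi.single 1 1) 0 r → W D f 1 r → W D (f + Pi.single 0 1) 1 r → G D (f + Pi.single 1 1) 0 - G D f 0 = Complex.I * (G D (f + Pi.single 0 1) 1 - G D f 1))) ∧ ¬ (∀ D : Literature.Probability.LatticeModels.DiscreteDobrushin, D.IsZdAdmissible → ((Literature.Probability.LatticeModels.discreteDomainGraph D.Ω D.δ).induce D.zdArcA).Preconnected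 → ∀ x x' i, W D x i (r + 2) → W D x' i (r + 2) → G D x i = G D x' i)) ∧ (let G : Literature.Probability.LatticeModels.DiscreteDobrushin → Literature.Probability.LatticeModels.Site 2 → Fin 2 → ℂ := fun D x i => ∫ cfg, (∑ k, g i k {e | Literature.Probability.LatticeModels.medialGraph.edist s((0 : Literature.Probability.LatticeModels.Site 2), Pi.single i 1) e ≤ (r : ℕ∞) ∧ Sym2.map (· + x) e ∈ cfg} * Literature.Probability.LatticeModels.passageSum (Literature.Probability.LatticeModels.fkInterface D cfg) D.δ (s i k) (Sym2.map (· + x) (z i k))) ∂(Literature.Probability.Percolation.bondPercolation (Literature.Probability.LatticeModels.zdGraph 2) Literature.Probability.Percolation.half); ∀ (D : Literature.Probability.RandomPlanarGeometry.DobrushinDomain) (E : ℝ → Literature.Probability.LatticeModels.DiscreteDobrushin), Literature.Probability.LatticeModels.ZdDiscretisationFamily D E → ∀ (φ : Literature.Probability.RandomPlanarGeometry.ConformalEquiv UpperHalfPlane.upperHalfPlaneSet D.carrier), D.IsChordalUniformizing φ → ∀ q : ℂ → ℂ, DifferentiableOn ℂ q D.carrier → (∀ w ∈ D.carrier, q w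 ^ 3 = deriv φ.symm w / φ.symm w) → ∃ c : ℝ → ℂ, ∀ i : Fin 2, TendstoLocallyUniformlyOn (fun (δ : ℝ) (w : ℂ) => c δ * G (E δ) (fun j => ⌊(if j = 0 then w.re else w.im) / δ⌋) i) q (𝓝[>] (0 : ℝ)) D.carrier)

/-- Stub `Prop` 2 — canonical SIZE (registered stub: the theorem `stub_canonicalAmplitude`). -/
def stub_canonicalAmplitude : Prop :=
  ∀ (r m : ℕ) (z : Fin 2 → Fin m → Literature.Probability.LatticeModels.MedialVertex) (s : Fin 2 → Fin m → ℝ) (g : Fin 2 → Fin m → Set Literature.Probability.LatticeModels.MedialVertex → ℂ), (∀ i k, Literature.Probability.LatticeModels.medialGraph.edist s((0 : Literature.Probability.LatticeModels.Site 2), Pi.single i 1) (z i k) ≤ (r : ℕ∞)) → (let G : Literature.Probability.LatticeModels.DiscreteDobrushin → Literature.Probability.LatticeModels.Site 2 → Fin 2 → ℂ := fun D x i => ∫ cfg, (∑ k, g i k {e | Literature.Probability.LatticeModels.medialGraph.edist s((0 : Literature.Probability.LatticeModels.Site 2), Pi.single i 1) e ≤ (r : ℕ∞) ∧ Sym2.map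 (· + x) e ∈ cfg} * Literature.Probability.LatticeModels.passageSum (Literature.Probability.LatticeModels.fkInterface D cfg) D.δ (s i k) (Sym2.map (· + x) (z i k))) ∂(Literature.Probability.Percolation.bondPercolation (Literature.Probability.LatticeModels.zdGraph 2) Literature.Probability.Percolation.half); let W : Literature.Probability.LatticeModels.DiscreteDobrushin → Literature.Probability.LatticeModels.Site 2 → Fin 2 → ℕ → Prop := fun D x i ρ => ∀ e, Literature.Probability.LatticeModels.medialGraph.edist s((0 : Literature.Probability.LatticeModels.Site 2), Pi.single i 1) e ≤ (ρ : ℕ∞) → Sym2.map (· + x) e ∈ D.innerMedialVertices; (∀ D : Literature.Probability.LatticeModels.DiscreteDobrushin, D.IsZdAdmissible → ((Literature.Probability.LatticeModels.discreteDomainGraph D.Ω D.δ).induce D.zdArcA).Preconnected → (∀ x, W D x 0 r → W D x 1 r → W D (x - Pi.single 0 1) 0 r → W D (x - Pi.single 1 1) 1 r → G D x 1 - G D (x - Pi.single 1 1) 1 = Complex.I * (G D x 0 - G D (x - Pi.single 0 1) 0)) ∧ (∀ f, W D f 0 r → W D (f + Pi.single 1 1) 0 r → W D f 1 r → W D (f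 + Pi.single 0 1) 1 r → G D (f + Pi.single 1 1) 0 - G D f 0 = Complex.I * (G D (f + Pi.single 0 1) 1 - G D f 1))) ∧ ¬ (∀ D : Literature.Probability.LatticeModels.DiscreteDobrushin, D.IsZdAdmissible → ((Literature.Probability.LatticeModels.discreteDomainGraph D.Ω D.δ).induce D.zdArcA).Preconnected → ∀ x x' i, W D x i (r + 2) → W D x' i (r + 2) → G D x i = G D x' i)) → ∃ C : ℝ, 0 < C ∧ (let G : Literature.Probability.LatticeModels.DiscreteDobrushin → Literature.Probability.LatticeModels.Site 2 → Fin 2 → ℂ := fun D x i => ∫ cfg, (∑ k, g i k {e | Literature.Probability.LatticeModels.medialGraph.edist s((0 : Literature.Probability.LatticeModels.Site 2), Pi.single i 1) e ≤ (r : ℕ∞) ∧ Sym2.map (· + x) e ∈ cfg} * Literature.Probability.LatticeModels.passageSum (Literature.Probability.LatticeModels.fkInterface D cfg) D.δ (s i k) (Sym2.map (· + x) (z i k))) ∂(Literature.Probability.Percolation.bondPercolation (Literature.Probability.LatticeModels.zdGraph 2) Literature.Probability.Percolation.half); ∀ (D : Literature.Probability.RandomPlanarGeometry.DobrushinDomain)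 (E : ℝ → Literature.Probability.LatticeModels.DiscreteDobrushin), Literature.Probability.LatticeModels.ZdDiscretisationFamily D E → ∀ (φ : Literature.Probability.RandomPlanarGeometry.ConformalEquiv UpperHalfPlane.upperHalfPlaneSet D.carrier), D.IsChordalUniformizing φ → ∀ q : ℂ → ℂ, DifferentiableOn ℂ q D.carrier → (∀ w ∈ D.carrier, q w ^ 3 = deriv φ.symm w / φ.symm w) → ∀ c : ℝ → ℂ, (∀ i : Fin 2, TendstoLocallyUniformlyOn (fun (δ : ℝ) (w : ℂ) => c δ * G (E δ) (fun j => ⌊(if j = 0 then w.re else w.im) / δ⌋) i) q (𝓝[>] (0 : ℝ)) D.carrier) → Filter.Tendsto (fun δ : ℝ => ‖c δ‖ * δ ^ (1 / 3 : ℝ)) (𝓝[>] (0 : ℝ)) (𝓝 C))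

end Stubs

/-! ### The registered stubs (the ONLY sorries of the file) -/

/-- stub 1 (canonical SHAPE; Smirnov 2010 Thm 2.2 modulo normalisation, at `σ = 1/3`): from a
witness of `DualCurrentTemplateR` one gets an exactly-CR, deep-window non-degenerate finite-range
template whose observable, after SOME complex normalisation `c_δ` (per domain, family,
uniformizer and branch; common to both edge types), converges to the canonical `q`,
`q³ = ψ'/ψ`, locally uniformly on `D`, for every Dobrushin domain, every
`ZdDiscretisationFamily`, every chordal uniformizer and every holomorphic branch. -/
theorem stub_projectiveShape :
    (Summit.CriticalPhenomena.CardyFormulaZ2.Theses.CardyDualCurrent.DualCurrentTemplateR → ∃ (r m : ℕ) (z : Fin 2 → Fin m → Literature.Probability.LatticeModels.MedialVertex) (s : Fin 2 → Fin m → ℝ) (g : Fin 2 → Fin m → Set Literature.Probability.LatticeModels.MedialVertex → ℂ), (∀ i k, Literature.Probability.LatticeModels.medialGraph.edist s((0 : Literature.Probability.LatticeModels.Site 2), Pi.single i 1) (z i k) ≤ (r : ℕ∞)) ∧ (let G : Literature.Probability.LatticeModels.DiscreteDobrushin → Literature.Probability.LatticeModels.Site 2 → Fin 2 → ℂ :=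 fun D x i => ∫ cfg, (∑ k, g i k {e | Literature.Probability.LatticeModels.medialGraph.edist s((0 : Literature.Probability.LatticeModels.Site 2), Pi.single i 1) e ≤ (r : ℕ∞) ∧ Sym2.map (· + x) e ∈ cfg} * Literature.Probability.LatticeModels.passageSum (Literature.Probability.LatticeModels.fkInterface D cfg) D.δ (s i k) (Sym2.map (· + x) (z i k))) ∂(Literature.Probability.Percolation.bondPercolation (Literature.Probability.LatticeModels.zdGraph 2) Literature.Probability.Percolation.half); let W : Literature.Probability.LatticeModels.DiscreteDobrushin → Literature.Probability.LatticeModels.Site 2 → Fin 2 → ℕ → Prop := fun D x i ρ => ∀ e, Literature.Probability.LatticeModels.medialGraph.edist s((0 : Literature.Probability.LatticeModels.Site 2), Pi.single i 1) e ≤ (ρ : ℕ∞) → Sym2.map (· + x) e ∈ D.innerMedialVertices; (∀ D : Literature.Probability.LatticeModels.DiscreteDobrushin, D.IsZdAdmissible → ((Literature.Probability.LatticeModels.discreteDomainGraph D.Ω D.δ).induce D.zdArcA).Preconnected → (∀ x, W D x 0 r → W D x 1 r → W D (x - Pi.single 0 1) 0 r → W D (x - Pi.single 1 1) 1 r → G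 D x 1 - G D (x - Pi.single 1 1) 1 = Complex.I * (G D x 0 - G D (x - Pi.single 0 1) 0)) ∧ (∀ f, W D f 0 r → W D (f + Pi.single 1 1) 0 r → W D f 1 r → W D (f + Pi.single 0 1) 1 r → G D (f + Pi.single 1 1) 0 - G D f 0 = Complex.I * (G D (f + Pi.single 0 1) 1 - G D f 1))) ∧ ¬ (∀ D : Literature.Probability.LatticeModels.DiscreteDobrushin, D.IsZdAdmissible → ((Literature.Probability.LatticeModels.discreteDomainGraph D.Ω D.δ).induce D.zdArcA).Preconnected → ∀ x x' i, W D x i (r + 2) → W D x' i (r + 2) → G D x i = G D x' i)) ∧ (let G : Literature.Probability.LatticeModels.DiscreteDobrushin → Literature.Probability.LatticeModels.Site 2 → Fin 2 → ℂ := fun D x i => ∫ cfg, (∑ k, g i k {e | Literature.Probability.LatticeModels.medialGraph.edist s((0 : Literature.Probability.LatticeModels.Site 2), Pi.single i 1) e ≤ (r : ℕ∞) ∧ Sym2.map (· + x) e ∈ cfg} * Literature.Probability.LatticeModels.passageSum (Literature.Probability.LatticeModels.fkInterface D cfg) D.δ (s i k) (Sym2.map (· + x) (z i k))) ∂(Literature.Probability.Percolation.bondPercolation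 (Literature.Probability.LatticeModels.zdGraph 2) Literature.Probability.Percolation.half); ∀ (D : Literature.Probability.RandomPlanarGeometry.DobrushinDomain) (E : ℝ → Literature.Probability.LatticeModels.DiscreteDobrushin), Literature.Probability.LatticeModels.ZdDiscretisationFamily D E → ∀ (φ : Literature.Probability.RandomPlanarGeometry.ConformalEquiv UpperHalfPlane.upperHalfPlaneSet D.carrier), D.IsChordalUniformizing φ → ∀ q : ℂ → ℂ, DifferentiableOn ℂ q D.carrier → (∀ w ∈ D.carrier, q w ^ 3 = deriv φ.symm w / φ.symm w) → ∃ c : ℝ → ℂ, ∀ i : Fin 2, TendstoLocallyUniformlyOn (fun (δ : ℝ) (w : ℂ) => c δ * G (E δ) (fun j => ⌊(if j = 0 then w.re else w.im) / δ⌋) i) q (𝓝[>] (0 : ℝ)) D.carrier)) := by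
  sorry

/-- stub 2 (canonical SIZE; sharp amplitude, universal lattice constant): for every exactly-CR,
deep-window non-degenerate finite-range template there is ONE `C > 0` such that any complex
normalisers realising the projective convergence of stub 1 (for any domain, family, uniformizer,
branch) satisfy `‖c_δ‖ · δ^{1/3} → C` as `δ → 0⁺`. -/
theorem stub_canonicalAmplitude :
    (∀ (r m : ℕ) (z : Fin 2 → Fin m → Literature.Probability.LatticeModels.MedialVertex) (s : Fin 2 → Fin m → ℝ) (g : Fin 2 → Fin m → Set Literature.Probability.LatticeModels.MedialVertex → ℂ), (∀ i k, Literature.Probability.LatticeModels.medialGraph.edist s((0 : Literature.Probability.LatticeModels.Site 2), Pi.single i 1) (z i k) ≤ (r : ℕ∞)) → (let G : Literature.Probability.LatticeModels.DiscreteDobrushin → Literature.Probability.LatticeModels.Site 2 → Fin 2 → ℂ := fun D x i => ∫ cfg, (∑ k, g i k {e | Literature.Probability.LatticeModels.medialGraph.edist s((0 : Literature.Probability.LatticeModels.Site 2), Pi.single i 1) e ≤ (r : ℕ∞) ∧ Sym2.map (· + x) e ∈ cfg} * Literature.Probability.LatticeModels.passageSum (Literature.Probability.LatticeModels.fkInterface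 D cfg) D.δ (s i k) (Sym2.map (· + x) (z i k))) ∂(Literature.Probability.Percolation.bondPercolation (Literature.Probability.LatticeModels.zdGraph 2) Literature.Probability.Percolation.half); let W : Literature.Probability.LatticeModels.DiscreteDobrushin → Literature.Probability.LatticeModels.Site 2 → Fin 2 → ℕ → Prop := fun D x i ρ => ∀ e, Literature.Probability.LatticeModels.medialGraph.edist s((0 : Literature.Probability.LatticeModels.Site 2), Pi.single i 1) e ≤ (ρ : ℕ∞) → Sym2.map (· + x) e ∈ D.innerMedialVertices; (∀ D : Literature.Probability.LatticeModels.DiscreteDobrushin, D.IsZdAdmissible → ((Literature.Probability.LatticeModels.discreteDomainGraph D.Ω D.δ).induce D.zdArcA).Preconnected → (∀ x, W D x 0 r → W D x 1 r → W D (x - Pi.single 0 1) 0 r → W D (x - Pi.single 1 1) 1 r → G D x 1 - G D (x - Pi.single 1 1) 1 = Complex.I * (G D x 0 - G D (x - Pi.single 0 1) 0)) ∧ (∀ f, W D f 0 r → W D (f + Pi.single 1 1) 0 r → W D f 1 r → W D (f + Pi.single 0 1) 1 r → G D (f + Pi.single 1 1) 0 - G D f 0 = Complex.I * (G D (f + Pi.single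 0 1) 1 - G D f 1))) ∧ ¬ (∀ D : Literature.Probability.LatticeModels.DiscreteDobrushin, D.IsZdAdmissible → ((Literature.Probability.LatticeModels.discreteDomainGraph D.Ω D.δ).induce D.zdArcA).Preconnected → ∀ x x' i, W D x i (r + 2) → W D x' i (r + 2) → G D x i = G D x' i)) → ∃ C : ℝ, 0 < C ∧ (let G : Literature.Probability.LatticeModels.DiscreteDobrushin → Literature.Probability.LatticeModels.Site 2 → Fin 2 → ℂ := fun D x i => ∫ cfg, (∑ k, g i k {e | Literature.Probability.LatticeModels.medialGraph.edist s((0 : Literature.Probability.LatticeModels.Site 2), Pi.single i 1) e ≤ (r : ℕ∞) ∧ Sym2.map (· + x) e ∈ cfg} * Literature.Probability.LatticeModels.passageSum (Literature.Probability.LatticeModels.fkInterface D cfg) D.δ (s i k) (Sym2.map (· + x) (z i k))) ∂(Literature.Probability.Percolation.bondPercolation (Literature.Probability.LatticeModels.zdGraph 2) Literature.Probability.Percolation.half); ∀ (D : Literature.Probability.RandomPlanarGeometry.DobrushinDomain) (E : ℝ → Literature.Probability.LatticeModels.DiscreteDobrushin), Literature.Probability.LatticeModels.ZdDiscretisationFamily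 D E → ∀ (φ : Literature.Probability.RandomPlanarGeometry.ConformalEquiv UpperHalfPlane.upperHalfPlaneSet D.carrier), D.IsChordalUniformizing φ → ∀ q : ℂ → ℂ, DifferentiableOn ℂ q D.carrier → (∀ w ∈ D.carrier, q w ^ 3 = deriv φ.symm w / φ.symm w) → ∀ c : ℝ → ℂ, (∀ i : Fin 2, TendstoLocallyUniformlyOn (fun (δ : ℝ) (w : ℂ) => c δ * G (E δ) (fun j => ⌊(if j = 0 then w.re else w.im) / δ⌋) i) q (𝓝[>] (0 : ℝ)) D.carrier) → Filter.Tendsto (fun δ : ℝ => ‖c δ‖ * δ ^ (1 / 3 : ℝ)) (𝓝[>] (0 : ℝ)) (𝓝 C))) := by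
  sorry

/-- **The composition** — hypotheses = the two stub `Prop`s BY NAME, conclusion = the crux BY
NAME: `Stubs.stub_projectiveShape → Stubs.stub_canonicalAmplitude →
CardyDualCurrent.CanonicalLimitFromExactCR`.  Take the template of stub 1, the constant `C` of
stub 2 for it; for given `(D, E, φ, q)` stub 1 gives normalisers `c_δ`, stub 2 their sharp size,
and `phase_normalisation` turns `(c_δ, C)` into the unit phases `θ_δ` of the crux. -/
theorem CanonicalLimitFromExactCR_of (h₁ : Stubs.stub_projectiveShape)
    (h₂ : Stubs.stub_canonicalAmplitude) : CanonicalLimitFromExactCR := by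
  unfold Stubs.stub_projectiveShape at h₁
  unfold Stubs.stub_canonicalAmplitude at h₂
  intro hA
  obtain ⟨r, m, z, s, g, hloc, hCR, hM⟩ := h₁ hA
  obtain ⟨C, hC, hS⟩ := h₂ r m z s g hloc hCR
  refine ⟨r, m, z, s, g, C, hC, hloc, ?_⟩
  intro G D E hE φ hφ q hq hq3
  obtain ⟨c, hc⟩ := hM D E hE φ hφ q hq hq3
  have hT := hS D E hE φ hφ q hq hq3 c hc
  obtain ⟨θ, hθ, hlim⟩ := phase_normalisation hC hq.continuousOn hc hT
  exact ⟨θ, hθ, hlim⟩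

/-- The skeleton IS the crux proof once the two registered stubs are discharged: the spelled-out
stub signatures are definitionally the named `Prop`s (an `example`, so that
`CanonicalLimitFromExactCR_of` stays the file's only theorem concluding the crux). -/
example : CanonicalLimitFromExactCR :=
  CanonicalLimitFromExactCR_of stub_projectiveShape stub_canonicalAmplitude

end Summit.CriticalPhenomena.CardyFormulaZ2.Cruxes.CanonicalLimitFromExactCR.Birth
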